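import Summits.AtomisticToContinuum.BoseEinsteinCondensation.Theorems.BECInsertionCorrectorStaticResponseBoundFewBodyFinal
import HarnessLib

/-!
# Skeleton (seat c3) of line `stable-fraction-square-completion`, seat-c2 layer, reduced to its irreducible core

`StaticResponseBound_of : StaticResponseBound` BY NAME from ONE registered stub, `stub_coreWeak` = the crux's
large-`N` (`N⁸ρa³ > 1`), linear-response-window (`t² ≤ ρa·max(ρa,|p|²)`, i.e. `ε = 1`) content, through the landed
unconditional equivalence `FewBody.staticResponseBound_iff_coreWeak` (p118508).  Everything else of the line
(few-body half `N⁸ρa³ ≤ c` with `C = 10`, trivial regimes, truncation of hard cores, `MaxFormBound`) is a theorem of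
the tree.  The stub is the N-uniform second-order (Bogoliubov) response bound of the dilute Bose gas in the
thermodynamic limit; see `CORE-c3.md` in the crux directory for why no line supplies it.
-/

noncomputable section

namespace Summit.AtomisticToContinuum.BoseEinsteinCondensation.Cruxes.StaticResponseBound.CoreC3

open MeasureTheory
open scoped ENNReal NNReal
open Literature.MathematicalPhysics.QuantumManyBody.BoseGas
open Summit.AtomisticToContinuum.BoseEinsteinCondensation.Theses
open Summit.AtomisticToContinuum.BoseEinsteinCondensation.Theses.BECInsertionCorrector
open Summit.AtomisticToContinuum.BoseEinsteinCondensation.Theorems.StaticResponseBound.Negative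
open Summit.AtomisticToContinuum.BoseEinsteinCondensation.Cruxes.StaticResponseBound.FewBody

/-- **Registered stub `stub_coreWeak` (crux-sized; the irreducible core).**  For every repulsive finite-range `v` and
every `c > 0` there are `ρ₀ > 0`, `C > 0` such that for `0 < ρ < ρ₀`, every `N` with `N⁸·ρa³ > c`, every `k ≠ 0`,
every coupling in the linear-response window `t² ≤ ρa·max(ρa,|p|²)` and every finite-energy periodic `Ψ`:
`E₀ − Ct²N/max(ρa,|p|²) ≤ E_Ψ + t⟨∑ⱼcos(p·xⱼ)⟩_Ψ`.  Equivalent to the crux (`staticResponseBound_iff_coreWeak`,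
`ε = 1`); its `t → 0` shadow is `χ_N(p) ≤ 2CN/max(ρa,|p|²)` uniformly in `N` (Bogoliubov: `N/(2(|p|²+16πρa))`). -/
theorem stub_coreWeak :
    ∀ v : ℝ → ℝ≥0∞, IsRepulsiveFiniteRange v → ∀ c : ℝ, 0 < c →
      ∃ ρ₀ : ℝ, 0 < ρ₀ ∧ ∃ C : ℝ, 0 < C ∧
        ∀ ρ : ℝ, 0 < ρ → ρ < ρ₀ → ∀ N : ℕ,
          c < (N : ℝ) ^ 8 * (ρ * (scatteringLength v).toReal ^ 3) →
          ∀ k : Fin 3 → ℤ, k ≠ 0 → ∀ t : ℝ,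
            t ^ 2 ≤ (1 : ℝ) ^ 2 * (ρ * (scatteringLength v).toReal) *
              max (ρ * (scatteringLength v).toReal) (psq (sideLength ρ N) k) →
            ∀ Ψ : PeriodicTrialState N (sideLength ρ N), periodicEnergy v Ψ ≠ ⊤ → Ineq v C ρ N k t Ψ := by
  sorry

/-- **Composition: the crux `StaticResponseBound` BY NAME from `stub_coreWeak`** (landed equivalence at `ε = 1`). -/
theorem StaticResponseBound_of : StaticResponseBound :=
  (staticResponseBound_iff_coreWeak one_pos).mpr stub_coreWeak

end Summit.AtomisticToContinuum.BoseEinsteinCondensation.Cruxes.StaticResponseBound.CoreC3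

end
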